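import Summits.ResolutionOfSingularities.ResolutionOfSingularities.Theorems.HilbertSamuelEliminationSigmaMaxModificationsCorridor3SigmaBoundaryOnSurface
import Literature.AlgebraicGeometry.Resolution.BlowupSNC
import Literature.AlgebraicGeometry.Resolution.MarkedIdealsRestrict
import Summits.ResolutionOfSingularities.ResolutionOfSingularities.Theorems.FrobeniusClosingPatchingRelPerfectDepthSNCPointwiseTransport
import HarnessLib

/-!
# [OURS · L1 W4.2] σ-LAYER (P1*) — `Corridor3SigmaBoundaryOnSurfaceList`: LAYER 2 of the snc / n.c. bridge — the LIST-LEVEL reading on the regular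
# surface (`restrictOff`, `SncListOn := HasSNC`, `IsNCListWithOn := HasSNCWith`, `ncLocusList`) and the B′ step law BY NAME (`HasSNCWith.hasSNC_transform`)

Additive over `…Corridor3SigmaBoundaryOnSurface` (LAYER 1, p538136: set-level skeleton `divisorSet`/`restrict`/`SncOn`/`IsNCWithOn`/`ncLocus`), per res-L1-w42-plan-1
RULINGS v3.14-35 (HS) «067 FILES LAYER 2 NOW» and -36 (IA) («`Ready_ofRecord E D := Scheme.IsRegular D.subscheme ∧ SncListOn E ι_D`»); CHAIN v3.21 §0t.3 (B″)
«PHASE B′ TARGET OF RECORD = LIST-LEVEL». Typer res-type-067 (g12). OURS (cell res-hironaka, slot W4.2); NOT statements of H. Hironaka's manuscript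
[Hironaka2017] nor of [CossartJannsenSaito2020] / [Kollar2007]; AI-typed, weaker than expert review. Helper VOCABULARY = bridge definitions (ABBREVIATIONS of
Literature `HasSNC` / `HasSNCWith` applied to the restricted boundary) + bookkeeping lemmas, `--supports stmt-ResolutionOfSingularities-19249 --as helper`
(counted 0); NO row is claimed; NO new snc notion.

* §1 `Boundary.restrictOff E ι` — the members whose support does NOT contain the image of `ι : D ⟶ W`, pulled back along `ι` (CJS Def. 4.1 quantifies over the
  boundary components NOT containing `D` — the `𝓑♭` of RULING -29 (GV); members `⊇ D` restrict to the whole of `D` and would obstruct `HasSNC` for no reason);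
  `restrictOff_sublist_restrict`, `divisorSet_restrictOff_subset`, `restrictOff_nil`.
* §2 THE LIST-LEVEL BRIDGE NAMES: `Boundary.SncListOn E ι := HasSNC (E.restrictOff ι)` (reduced regular traces with pairwise distinct parameters at every point
  of `D` — the PHASE B′ TARGET of record), `Boundary.IsNCListWithOn E ι C := HasSNCWith (E.restrictOff ι) C` for a centre `C : D.IdealSheafData` (every B′ centre),
  `Boundary.ncLocusList E ι := {q | ¬ IsNCListWithOn E ι (𝓘 {q})}`, `Boundary.ReadyOn E ι := Scheme.IsRegular D ∧ SncListOn E ι` and its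
  instance of record **`ReadyOfRecord W E N ν D := E.ReadyOn (menuCentre D).subschemeι`** (RULING -36 (IA)'s `Ready_ofRecord`, in the binder shape of o1's
  `SurfaceReadiness`; `readyOfRecord_iff`, `ReadyOfRecord.isRegular` = o1's `hReady` obligation, `ReadyOfRecord.sncListOn`); comparisons `SncListOn.divisorSet_isSNC` (list-level ⇒ set-level snc of the filtered traces, Literature
  `HasSNC.isStrictNormalCrossingsDivisor_biUnion_support`), `IsNCListWithOn.sncListOn` (= Literature `HasSNCWith.hasSNC`), `isNCListWithOn_of_hasSNCWith_restrict` (full ⇒ filtered, Literature `HasSNCWith.sublist`).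
* §3 THE B′ STEP LAW, LIST LEVEL, BY NAME: `Boundary.sncList_next_of_isNCListWithOn` = Literature `HasSNCWith.hasSNC_transform` (BlowupSNC; CJS Lemma 4.2 /
  BGMW 3.1.3) read in boundary vocabulary: if the centre `C` has list-level normal crossings with the filtered traces on the (locally Noetherian) carrier `D`,
  then after the blow-up `π : D' ⟶ D` of `C` the transformed list «strict transforms ++ [exceptional]» has simple normal crossings on `D'` — for
  `π = blowup.π C` this is `HasSNC ((E.restrictOff ι).next C)` in o1's `Boundary.next` notation. The W-side identification (D' = strict transform of `D̃`,
  (g1)/(g2) of RULING -36 (IC), Literature `IsBlowup.isBlowup_subscheme_controlledTransform` / `IsBlowup.comap_subschemeι_controlledTransform`) is res-type-001's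
  `…SigmaSurfaceStrictTransform` glue and is NOT restated here. (rev 2, tri-2 v11.0a (V1): §3 is the law for a centre that is list-n.c. with an
  ALREADY snc configuration — the later n.c. centres —, NOT the B′ progress law.)
* §4 (rev 2, tri-2 v11.0a (V1)–(V4)) THE POINTWISE WORK LIST: `Boundary.badLocus Γs := {q | ¬ DepthSNC.SNCWithAt Γs ⊤ q}`, `badLocusWith`,
  `hasSNC_iff_badLocus_eq_empty`, **`Boundary.ncLocusPt E ι := (E.restrictOff ι).badLocus`** (B′'s work list of record; `sncListOn_iff_ncLocusPt_eq_empty`),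
  and the B′ STEP LAW OFF THE CENTRE `badLocus_transform_subset(_preimage_union)` / `badLocus_next_subset`: `bad(Γs′) ⊆ ρ⁻¹(bad(Γs) ∪ V(C))`
  (tree `IsBlowup.sncWithAt_transform`, pointwise Kollár 3.25).
-/

noncomputable section

set_option linter.dupNamespace false

open CategoryTheory AlgebraicGeometry TopologicalSpace
open Summit.ResolutionOfSingularities.ResolutionOfSingularities.Theorems.CampaignW42
open Literature.AlgebraicGeometry.Resolution Literature.RingTheory.HilbertSamuel

namespace Summit.ResolutionOfSingularities.ResolutionOfSingularities.Theorems.SigmaMaxModificationsCorridor3.Sigma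

universe u

variable {W D : Scheme.{u}}

/-! ## §1. The filtered restriction: only the members NOT containing `D` -/

open scoped Classical in
/-- [OURS · L1 W4.2] **THE BOUNDARY RESTRICTED ALONG `ι`, MEMBERS CONTAINING `D` DROPPED** (`𝓑♭`): keep the members whose support does not contain the
image of `ι`, and pull them back (`Γ_j := E_j|_D`). NOT a statement of the manuscript. [cite: CossartJannsenSaito2020, Def. 4.1 (p. 49)] -/
def Boundary.restrictOff (E : Boundary W) (ι : D ⟶ W) : Boundary D :=
  (E.filter fun I => ¬ (Set.range ι.base ⊆ (I.support : Set W))).map fun I => I.comap ι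

/-- The filtered restriction is a sub-list of the full restriction. [folklore] -/
theorem Boundary.restrictOff_sublist_restrict (E : Boundary W) (ι : D ⟶ W) : (E.restrictOff ι).Sublist (E.restrict ι) := by
  classical
  exact (List.filter_sublist).map _

/-- Hence at most as many members. [folklore] -/
theorem Boundary.length_restrictOff_le (E : Boundary W) (ι : D ⟶ W) : (E.restrictOff ι).length ≤ E.length := by
  rw [← E.length_restrict ι]; exact (E.restrictOff_sublist_restrict ι).length_le

/-- Filtering the empty boundary. [folklore] -/
@[simp] theorem Boundary.restrictOff_nil (ι : D ⟶ W) : Boundary.restrictOff ([] : Boundary W) ι = [] := by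
  classical
  simp [Boundary.restrictOff]

/-- Membership in the filtered restriction. [folklore] -/
theorem Boundary.mem_restrictOff_iff {E : Boundary W} {ι : D ⟶ W} {J : D.IdealSheafData} :
    J ∈ E.restrictOff ι ↔ ∃ I ∈ E, ¬ (Set.range ι.base ⊆ (I.support : Set W)) ∧ I.comap ι = J := by
  classical
  simp [Boundary.restrictOff, List.mem_filter, and_assoc]

/-- The filtered traces lie in the full trace configuration. [folklore] -/
theorem Boundary.divisorSet_restrictOff_subset (E : Boundary W) (ι : D ⟶ W) : (E.restrictOff ι).divisorSet ⊆ (E.restrict ι).divisorSet := by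
  intro q hq
  obtain ⟨J, hJ, hqJ⟩ := Boundary.mem_divisorSet_iff.mp hq
  exact Boundary.mem_divisorSet_iff.mpr ⟨J, (E.restrictOff_sublist_restrict ι).subset hJ, hqJ⟩

/-! ## §2. The list-level bridge names -/

/-- [OURS · L1 W4.2 · BRIDGE] **«THE FILTERED TRACES HAVE SIMPLE NORMAL CROSSINGS ON `D`»** := Literature `HasSNC (E.restrictOff ι)` — the PHASE B′ TARGET OF
RECORD (list level: at every `q ∈ D` a regular system of parameters of `𝒪_{D,q}` cutting out each trace through `q` by ONE parameter, distinct traces by distinct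
parameters; so traces are reduced and regular and no two share a component). NOT a statement of the manuscript. [folklore] -/
abbrev Boundary.SncListOn (E : Boundary W) (ι : D ⟶ W) : Prop :=
  HasSNC (E.restrictOff ι)

/-- [OURS · L1 W4.2 · BRIDGE] **«THE CENTRE `C` HAS (list-level) NORMAL CROSSINGS WITH THE FILTERED TRACES»** := Literature `HasSNCWith (E.restrictOff ι) C`
(`C : D.IdealSheafData`; every PHASE B′ centre and the final `D̃` itself carry this). NOT a statement of the manuscript. [cite: CossartJannsenSaito2020, Def. 4.1 (p. 49)] -/
abbrev Boundary.IsNCListWithOn (E : Boundary W) (ι : D ⟶ W) (C : D.IdealSheafData) : Prop :=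
  HasSNCWith (E.restrictOff ι) C

/-- [OURS · L1 W4.2] **THE LIST-LEVEL NON-N.C. LOCUS `NC_list(D, E)`** — PHASE B′'s work list: the points `q ∈ D` whose point ideal `𝓘(q̄)` is not
list-n.c. with the filtered traces. NOT a statement of the manuscript. [folklore] -/
def Boundary.ncLocusList (E : Boundary W) (ι : D ⟶ W) : Set D :=
  {q | ¬ E.IsNCListWithOn ι (Scheme.IdealSheafData.vanishingIdeal ⟨closure {q}, isClosed_closure⟩)}

/-- [OURS · L1 W4.2 · BRIDGE] **«`D` IS READY»** (RULING v3.14-36 (IA) `Ready_ofRecord`, read on the carrier): `D` regular and the filtered traces snc on `D`.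
NOT a statement of the manuscript. [folklore] -/
abbrev Boundary.ReadyOn (E : Boundary W) (ι : D ⟶ W) : Prop :=
  Scheme.IsRegular D ∧ E.SncListOn ι

/-- [OURS · L1 W4.2 · BRIDGE] **`Ready_ofRecord` — THE READINESS INSTANCE OF RECORD** (RULING v3.14-36 (IA)), in the binder shape of res-L1-type-o1's
`SurfaceReadiness := ∀ W, Boundary W → ℕ → (ℕ → ℕ) → Closeds W → Prop` (file `…SigmaMenuSurfacePhase`, `StrategyE.surfacePhase Ready prep`): the surface
`D : Closeds W` is READY iff its reduced subscheme `(menuCentre D).subscheme` is regular and the filtered boundary traces have simple normal crossings on it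
(read along `(menuCentre D).subschemeι`). Independent of `N`, `ν` (readiness is a property of `(E, D)` alone, (IA)). NOT a statement of the manuscript.
[folklore] -/
def ReadyOfRecord (W : Scheme.{u}) (E : Boundary W) (_N : ℕ) (_ν : ℕ → ℕ) (D : Closeds W) : Prop :=
  E.ReadyOn (menuCentre D).subschemeι

/-- Unfolding `ReadyOfRecord`. [folklore] -/
theorem readyOfRecord_iff {E : Boundary W} {N : ℕ} {ν : ℕ → ℕ} {D : Closeds W} :
    ReadyOfRecord W E N ν D ↔ Scheme.IsRegular (menuCentre D).subscheme ∧ E.SncListOn (menuCentre D).subschemeι :=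
  Iff.rfl

/-- **READY ⇒ REGULAR** — the `hReady` obligation of o1's `StrategyE.surfacePhase_isStratumDisciplined` for the instance of record. [folklore] -/
theorem ReadyOfRecord.isRegular {E : Boundary W} {N : ℕ} {ν : ℕ → ℕ} {D : Closeds W} (h : ReadyOfRecord W E N ν D) :
    Scheme.IsRegular (menuCentre D).subscheme :=
  h.1

/-- **READY ⇒ THE FILTERED TRACES ARE SNC ON `D`.** [folklore] -/
theorem ReadyOfRecord.sncListOn {E : Boundary W} {N : ℕ} {ν : ℕ → ℕ} {D : Closeds W} (h : ReadyOfRecord W E N ν D) :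
    E.SncListOn (menuCentre D).subschemeι :=
  h.2

/-- **LIST-LEVEL ⇒ SET-LEVEL**: if the filtered traces have simple normal crossings then their support configuration is a strict-normal-crossings divisor on `D`
(Literature `HasSNC.isStrictNormalCrossingsDivisor_biUnion_support`). [folklore] -/
theorem Boundary.SncListOn.divisorSet_isSNC {E : Boundary W} {ι : D ⟶ W} (h : E.SncListOn ι) :
    IsStrictNormalCrossingsDivisor D (E.restrictOff ι).divisorSet :=
  h.isStrictNormalCrossingsDivisor_biUnion_support

/-- The `C = ⊤` reading: the traces themselves are snc whenever some centre is list-n.c. with them (`HasSNCWith E C` carries `HasSNC E`'s data). [folklore] -/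
theorem Boundary.IsNCListWithOn.sncListOn {E : Boundary W} {ι : D ⟶ W} {C : D.IdealSheafData} (h : E.IsNCListWithOn ι C) : E.SncListOn ι :=
  HasSNCWith.hasSNC h

/-- **FULL ⇒ FILTERED** (forgetting the members `⊇ D`, Literature `HasSNCWith.sublist`, BGMW §4 Step 1a): list-n.c. of a centre with ALL traces gives
list-n.c. with the filtered traces. [cite: BierstoneGrigorievMilmanWlodarczyk2011, §4 Step 1a] -/
theorem Boundary.isNCListWithOn_of_hasSNCWith_restrict {E : Boundary W} {ι : D ⟶ W} {C : D.IdealSheafData} (h : HasSNCWith (E.restrict ι) C) :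
    E.IsNCListWithOn ι C :=
  h.sublist (E.restrictOff_sublist_restrict ι)

/-! ## §3. The PHASE B′ step law, list level, BY NAME -/

/-- [OURS · L1 W4.2 · BRIDGE] **THE B′ STEP LAW (list level) = Literature `HasSNCWith.hasSNC_transform`** (CJS Lemma 4.2 / BGMW Def. 3.1.3 (2),(4) / Kollár Def. 3.25)
in boundary vocabulary: on the (locally Noetherian) carrier `D`, a centre `C` that is list-n.c. with the filtered traces yields, after ANY blow-up `π : D' ⟶ D` of
`C`, a list «strict transforms of the traces ++ [exceptional]» with simple normal crossings on `D'`. [cite: CossartJannsenSaito2020, Lemma 4.2]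
[cite: Kollar2007, Def. 3.25] -/
theorem Boundary.sncList_transform_of_isNCListWithOn [IsLocallyNoetherian D] {D' : Scheme.{u}} {π : D' ⟶ D} {E : Boundary W} {ι : D ⟶ W}
    {C : D.IdealSheafData} (h : E.IsNCListWithOn ι C) (hπ : IsBlowup π C) :
    HasSNC ((E.restrictOff ι).map (strictTransformIdeal π C) ++ [C.comap π]) :=
  h.hasSNC_transform hπ

/-- … in o1's `Boundary.next` notation for the chosen blow-up `blowup.π C`: the transformed filtered boundary has simple normal crossings on `blowup C`.
[folklore] -/
theorem Boundary.sncList_next_of_isNCListWithOn [IsLocallyNoetherian D] {E : Boundary W} {ι : D ⟶ W} {C : D.IdealSheafData}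
    (h : E.IsNCListWithOn ι C) : HasSNC ((E.restrictOff ι).next C) :=
  h.hasSNC_transform (blowup.isBlowup C)

/-! ## §4. (rev 2) The POINTWISE work list of PHASE B′ and its persistence law off the centre

res-L1-w42-tri-2 TRIAGE v11.0a (V1)–(V4): `IsNCListWithOn`/`ncLocusList` (§2) are GLOBAL (`HasSNCWith` quantifies over every point of `D`), so
`ncLocusList` is all of `D` as soon as the traces fail snc anywhere, and §3 fires only for a centre that is list-n.c. with an ALREADY snc trace
configuration (its role: the law for the LATER n.c. centres, not the B′ progress law). The B′ work list is the POINTWISE bad locus below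
(tree `DepthSNC.SNCWithAt`, `…FrobeniusClosingPatchingRelPerfectDepthSNCPointwise`), and the B′ step law OFF the centre is the pointwise transport
`IsBlowup.sncWithAt_transform` (`…DepthSNCPointwiseTransport`); progress OVER the centre is the embedded-resolution count (F-75
`Stacks0BIC_embeddedResolutionCurvesInSurfaces`), not stated here. -/

/-- [OURS · L1 W4.2] **THE BAD LOCUS OF A TRACE LIST** (pointwise): the points of `D` at which the list `Γs` is NOT simple-normal-crossings
(tree `DepthSNC.SNCWithAt Γs ⊤ q`). NOT a statement of the manuscript. [folklore] -/
def Boundary.badLocus (Γs : Boundary D) : Set D :=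
  {q | ¬ DepthSNC.SNCWithAt Γs ⊤ q}

/-- … and relative to a centre `C` (the centre clause of `SNCWithAt` added at the points of `V(C)`). [folklore] -/
def Boundary.badLocusWith (Γs : Boundary D) (C : D.IdealSheafData) : Set D :=
  {q | ¬ DepthSNC.SNCWithAt Γs C q}

/-- Membership. [folklore] -/
@[simp] theorem Boundary.mem_badLocus_iff {Γs : Boundary D} {q : D} : q ∈ Γs.badLocus ↔ ¬ DepthSNC.SNCWithAt Γs ⊤ q :=
  Iff.rfl

/-- Membership. [folklore] -/
@[simp] theorem Boundary.mem_badLocusWith_iff {Γs : Boundary D} {C : D.IdealSheafData} {q : D} :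
    q ∈ Γs.badLocusWith C ↔ ¬ DepthSNC.SNCWithAt Γs C q :=
  Iff.rfl

/-- **A LIST IS SNC IFF ITS BAD LOCUS IS EMPTY** (tree `DepthSNC.hasSNCWith_iff_sncWithAt`). [folklore] -/
theorem Boundary.hasSNC_iff_badLocus_eq_empty {Γs : Boundary D} : HasSNC Γs ↔ Γs.badLocus = ∅ := by
  rw [HasSNC, DepthSNC.hasSNCWith_iff_sncWithAt, Set.eq_empty_iff_forall_notMem]
  exact forall_congr' fun q => by rw [Boundary.mem_badLocus_iff, not_not]

/-- The bad locus relative to a centre exceeds the plain one only on the centre: `bad(Γs, C) ⊆ bad(Γs) ∪ V(C)`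
(tree `DepthSNC.SNCWithAt.of_not_mem_support`). [folklore] -/
theorem Boundary.badLocusWith_subset (Γs : Boundary D) (C : D.IdealSheafData) : Γs.badLocusWith C ⊆ Γs.badLocus ∪ (C.support : Set D) := by
  intro q hq
  by_cases hqC : q ∈ (C.support : Set D)
  · exact Or.inr hqC
  · exact Or.inl fun h => hq (h.of_not_mem_support hqC)

/-- Conversely `bad(Γs) ⊆ bad(Γs, C)` (tree `DepthSNC.SNCWithAt.top`). [folklore] -/
theorem Boundary.badLocus_subset_badLocusWith (Γs : Boundary D) (C : D.IdealSheafData) : Γs.badLocus ⊆ Γs.badLocusWith C :=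
  fun _ hq h => hq h.top

/-- [OURS · L1 W4.2] **THE POINTWISE NON-N.C. LOCUS `NC(D, E)` — PHASE B′'s WORK LIST OF RECORD** (rev 2; replaces the role mis-assigned to the global
`ncLocusList` of §2): the bad locus of the filtered traces. NOT a statement of the manuscript. [folklore] -/
def Boundary.ncLocusPt (E : Boundary W) (ι : D ⟶ W) : Set D :=
  (E.restrictOff ι).badLocus

/-- Unfolding. [folklore] -/
theorem Boundary.ncLocusPt_eq (E : Boundary W) (ι : D ⟶ W) : E.ncLocusPt ι = (E.restrictOff ι).badLocus :=
  rfl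

/-- **`SncListOn` IFF THE WORK LIST IS EMPTY** — B′ runs exactly while `ncLocusPt` is non-empty. [folklore] -/
theorem Boundary.sncListOn_iff_ncLocusPt_eq_empty {E : Boundary W} {ι : D ⟶ W} : E.SncListOn ι ↔ E.ncLocusPt ι = ∅ :=
  Boundary.hasSNC_iff_badLocus_eq_empty

/-- **THE B′ STEP LAW OFF THE CENTRE (pointwise persistence)**: after the blow-up `ρ : D′ ⟶ D` of a centre `C` on the carrier, a point of `D′` is bad
for the transformed list «strict transforms ++ [exceptional]» only if it lies over a point that was bad RELATIVE TO `C` — in particular (next lemma)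
over the old bad locus or over the centre (tree `IsBlowup.sncWithAt_transform`, Kollár Def. 3.25 pointwise). [cite: Kollar2007, Def. 3.25] -/
theorem Boundary.badLocus_transform_subset [IsLocallyNoetherian D] {D' : Scheme.{u}} {ρ : D' ⟶ D} {C : D.IdealSheafData} (hρ : IsBlowup ρ C)
    (Γs : Boundary D) : Boundary.badLocus (Γs.map (strictTransformIdeal ρ C) ++ [C.comap ρ]) ⊆ ρ.base ⁻¹' Γs.badLocusWith C := by
  intro q' hq'
  rw [Set.mem_preimage, Boundary.mem_badLocusWith_iff]
  exact fun h => hq' (hρ.sncWithAt_transform q' h)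

/-- … hence `bad(Γs′) ⊆ ρ⁻¹ (bad(Γs) ∪ V(C))`: snc persists at every point off the centre's fibre and off the old bad locus. [cite: Kollar2007, Def. 3.25] -/
theorem Boundary.badLocus_transform_subset_preimage_union [IsLocallyNoetherian D] {D' : Scheme.{u}} {ρ : D' ⟶ D} {C : D.IdealSheafData}
    (hρ : IsBlowup ρ C) (Γs : Boundary D) :
    Boundary.badLocus (Γs.map (strictTransformIdeal ρ C) ++ [C.comap ρ]) ⊆ ρ.base ⁻¹' (Γs.badLocus ∪ (C.support : Set D)) :=
  (Boundary.badLocus_transform_subset hρ Γs).trans (Set.preimage_mono (Γs.badLocusWith_subset C))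

/-- … in o1's `Boundary.next` notation on the carrier (`ρ = blowup.π C`). [folklore] -/
theorem Boundary.badLocus_next_subset [IsLocallyNoetherian D] (Γs : Boundary D) (C : D.IdealSheafData) :
    (Γs.next C).badLocus ⊆ (blowup.π C).base ⁻¹' (Γs.badLocus ∪ (C.support : Set D)) :=
  Boundary.badLocus_transform_subset_preimage_union (blowup.isBlowup C) Γs

/-! ## §5. (rev 2) READINESS WITH THE TRUE-SET CLAUSE — the instance of record from rev 2 on

res-L1-w42-tri-2 TRIAGE v11.0a (V5): Literature `HasSNC` reads a list through its member SET, so two distinct boundary members with EQUAL traces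
(DiagonalFace: `E = {V(u₁), V(u₂)}`, `D̃ = V(y, u₁ − u₂)`) pass `SncListOn` although `D̃` is not n.c. with `E₁ ∩ E₂`; CJS Def. 4.2 demands the pulled-back
multiset to be a TRUE SET. `ReadyOn`/`ReadyOfRecord` (rev 1, landed p540435) are kept (append-only tree) but SUPERSEDED AS THE INSTANCE OF RECORD by
`ReadyTSOn`/`ReadyTSOfRecord` below (same binder shape; o1's `hReady` obligation is still `.isRegular`). -/

/-- [OURS · L1 W4.2 · BRIDGE] **«`D` IS READY» WITH THE TRUE-SET CLAUSE**: `D` regular, filtered traces snc on `D`, and the filtered traces pairwise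
distinct as ideals of `D`. NOT a statement of the manuscript. [cite: CossartJannsenSaito2020, Def. 4.2] -/
abbrev Boundary.ReadyTSOn (E : Boundary W) (ι : D ⟶ W) : Prop :=
  E.ReadyOn ι ∧ (E.restrictOff ι).Nodup

/-- [OURS · L1 W4.2 · BRIDGE] **`Ready_ofRecord` FROM rev 2 ON** — the readiness instance of record WITH the true-set clause, in o1's `SurfaceReadiness`
binder shape (supersedes `ReadyOfRecord` of rev 1 in that role). NOT a statement of the manuscript. [cite: CossartJannsenSaito2020, Def. 4.2] -/
def ReadyTSOfRecord (W : Scheme.{u}) (E : Boundary W) (_N : ℕ) (_ν : ℕ → ℕ) (D : Closeds W) : Prop :=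
  E.ReadyTSOn (menuCentre D).subschemeι

/-- Unfolding `ReadyTSOfRecord`. [folklore] -/
theorem readyTSOfRecord_iff {E : Boundary W} {N : ℕ} {ν : ℕ → ℕ} {D : Closeds W} :
    ReadyTSOfRecord W E N ν D ↔ (Scheme.IsRegular (menuCentre D).subscheme ∧ E.SncListOn (menuCentre D).subschemeι) ∧
      (E.restrictOff (menuCentre D).subschemeι).Nodup :=
  Iff.rfl

/-- The true-set readiness refines rev 1's. [folklore] -/
theorem ReadyTSOfRecord.readyOfRecord {E : Boundary W} {N : ℕ} {ν : ℕ → ℕ} {D : Closeds W} (h : ReadyTSOfRecord W E N ν D) :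
    ReadyOfRecord W E N ν D :=
  h.1

/-- **READY ⇒ REGULAR** (o1's `hReady` obligation, unchanged). [folklore] -/
theorem ReadyTSOfRecord.isRegular {E : Boundary W} {N : ℕ} {ν : ℕ → ℕ} {D : Closeds W} (h : ReadyTSOfRecord W E N ν D) :
    Scheme.IsRegular (menuCentre D).subscheme :=
  h.1.1

/-- **READY ⇒ FILTERED TRACES SNC.** [folklore] -/
theorem ReadyTSOfRecord.sncListOn {E : Boundary W} {N : ℕ} {ν : ℕ → ℕ} {D : Closeds W} (h : ReadyTSOfRecord W E N ν D) :
    E.SncListOn (menuCentre D).subschemeι :=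
  h.1.2

/-- **READY ⇒ FILTERED TRACES PAIRWISE DISTINCT** (CJS Def. 4.2 «true set»). [cite: CossartJannsenSaito2020, Def. 4.2] -/
theorem ReadyTSOfRecord.nodup {E : Boundary W} {N : ℕ} {ν : ℕ → ℕ} {D : Closeds W} (h : ReadyTSOfRecord W E N ν D) :
    (E.restrictOff (menuCentre D).subschemeι).Nodup :=
  h.2

/-- **READY ⇒ EMPTY WORK LIST.** [folklore] -/
theorem ReadyTSOfRecord.ncLocusPt_eq_empty {E : Boundary W} {N : ℕ} {ν : ℕ → ℕ} {D : Closeds W} (h : ReadyTSOfRecord W E N ν D) :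
    E.ncLocusPt (menuCentre D).subschemeι = ∅ :=
  Boundary.sncListOn_iff_ncLocusPt_eq_empty.mp h.sncListOn

end Summit.ResolutionOfSingularities.ResolutionOfSingularities.Theorems.SigmaMaxModificationsCorridor3.Sigma

end
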